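import Summits.CriticalPhenomena.SAWScalingLimit.Theorems.SAWTotalPositivityBoundaryTP2Defs
import Summits.CriticalPhenomena.SAWScalingLimit.Theorems.SAWTotalPositivityBoundaryTP2Symmetry
import Summits.CriticalPhenomena.SAWScalingLimit.Theorems.SAWTotalPositivityBoundaryTP2Avoid
import Summits.CriticalPhenomena.SAWScalingLimit.Theorems.SAWTotalPositivityBoundaryTP2SquareGadget
import Summits.CriticalPhenomena.SAWScalingLimit.Theorems.SAWTotalPositivityBoundaryTP2Strip4RecCornerAux
import Summits.CriticalPhenomena.SAWScalingLimit.Theorems.SAWTotalPositivityBoundaryTP2Strip4RecPair302Aux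
import Summits.CriticalPhenomena.SAWScalingLimit.Theorems.EdgeOfPositivity.Negative.EdgeOfPositivityRectDomain
import HarnessLib

/-!
# Crux `BoundaryTP2` (stmt-CriticalPhenomena-7115), line `Sketch`: width-4 transfer, the pair
kernel whose loop spans the middle of the last column

Tool stub `stub_strip4_recPair302` of the line's skeleton (the 4-row strip programme). On the
strips `S_L = discreteDomainGraph (rectDomain L 3) 1` (sites `{0..L} × {0,1,2,3}`, lattice
adjacency), with the rows labelled `ρ ∈ {(0,1,2,3), (3,2,1,0)}` (mirror images), write
`p_j = (L,ρ_j)`, `m_j = (L+1,ρ_j)`, `a = (0,r)`, `t = m₃`, and `PP_K(a→t; u→v)` for the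
disjoint-pair kernel (sum of `x^{|γ|+|γ'|}` over the vertex-disjoint self-avoiding `γ : a → t`,
`γ' : u → v` of `K`). Then

  `PP_{S_{L+1}}(a→t; m₀→m₂) = x³ Z_{S_L}(a,p₃) + x⁴ PP_{S_L}(a→p₃; p₀→p₁)
                              + x³ PP_{S_L}(a→p₃; p₀→p₂) + x⁴ PP_{S_L}(a→p₃; p₁→p₂)`.

Combinatorially: the loop `γ'` is the column segment `m₀ m₁ m₂` (`x³ Z`), or dips
`m₀ m₁ p₁ ⋯ p₂ m₂` (`x⁴ PP(p₁→p₂)`), or starts `m₀ p₀ ⋯` and re-enters the column at `m₂` from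
`p₂` (`x³ PP(p₀→p₂)`) or at `m₁` from `p₁` (`x⁴ PP(p₀→p₁)`); the main path enters `t` from `p₃`.
Proof: peel the new column vertex by vertex with the generic identities of the disjoint-pair
kernel — first step of the loop at `m₀` (neighbours `p₀`, `m₁`), then at `m₂` resp. `m₁` in the
vertex-deleted graphs (`pairSum_firstStep_pair/triple`, `…Strip4RecPair302Aux`), first step out
of / last step into a pendant vertex and deletion of the stranded pendant `m₁`
(`s4c_pair_leaf_start/end/irrel`, `…Strip4RecCornerAux`), the trivial loop as a `pathKernelOn`
(`pairSum_nil`, `stub_pathKernelOn_avoid`, `pathKernel_firstStep_single`) — and identify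
`S_{L+1}` minus its last column with `S_L` (coordinate bookkeeping on `Site 2` closed by `omega`,
for both labellings at once).
-/

noncomputable section

namespace Summit.CriticalPhenomena.SAWScalingLimit.Theorems.BoundaryTP2

open SimpleGraph Walk
open Literature.Probability.LatticeModels Literature.Probability.RandomPlanarGeometry
open Summit.CriticalPhenomena.SAWScalingLimit.Theorems.EdgeOfPositivity.Negative
open scoped ENNReal

/-! ## Coordinates on the 4-row strips -/

/-- Adjacency in `ℤ²` in coordinates. [folklore] -/
private theorem s4q_zd_adj_iff (u v : Site 2) :
    (zdGraph 2).Adj u v ↔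
      ((v 0 = u 0 + 1 ∨ u 0 = v 0 + 1) ∧ v 1 = u 1) ∨
        ((v 1 = u 1 + 1 ∨ u 1 = v 1 + 1) ∧ v 0 = u 0) := by
  -- adapted from `ladder_zd_adj_iff` (…BoundaryTP2LadderKernels)
  rw [zdGraph_adj_iff, Fin.exists_fin_two]
  simp only [funext_iff, Fin.forall_fin_two, Pi.add_apply, Pi.single_eq_same,
    Pi.single_eq_of_ne (one_ne_zero : (1 : Fin 2) ≠ 0),
    Pi.single_eq_of_ne (zero_ne_one : (0 : Fin 2) ≠ 1), add_zero]
  omega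

/-- A site equals `st a b` iff its two coordinates are `a` and `b`. [folklore] -/
private theorem s4q_eq_st_iff (v : Site 2) (a b : ℤ) : v = st a b ↔ v 0 = a ∧ v 1 = b :=
  ⟨fun h => h ▸ ⟨rfl, rfl⟩, fun h => by rw [← st_eta v, h.1, h.2]⟩

/-- Sites with different coordinates are different. [folklore] -/
private theorem s4q_ne {i j i' j' : ℤ} (h : i ≠ i' ∨ j ≠ j') : st i j ≠ st i' j' := by
  rw [Ne, s4q_eq_st_iff, st_zero, st_one]
  omega

/-- Adjacency of the 4-row strip `{0..n} × {0,1,2,3}` in coordinates. [folklore] -/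
private theorem s4q_adj_iff (n : ℕ) (u v : Site 2) :
    (discreteDomainGraph (rectDomain n 3) 1).Adj u v ↔
      (((v 0 = u 0 + 1 ∨ u 0 = v 0 + 1) ∧ v 1 = u 1) ∨
          ((v 1 = u 1 + 1 ∨ u 1 = v 1 + 1) ∧ v 0 = u 0)) ∧
        ((0 ≤ u 0 ∧ u 0 ≤ n) ∧ (0 ≤ u 1 ∧ u 1 ≤ 3)) ∧
          ((0 ≤ v 0 ∧ v 0 ≤ n) ∧ (0 ≤ v 1 ∧ v 1 ≤ 3)) := by
  rw [adj_rect_iff, s4q_zd_adj_iff, mem_rectSites_iff, mem_rectSites_iff, Nat.cast_ofNat]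

/-- Deleting the four sites of the last column of `S_{L+1}` (in any order) leaves `S_L`, as
graphs on `Site 2`. [folklore] -/
private theorem s4q_delete_column (L : ℕ) (r0 r1 r2 r3 : ℤ)
    (hρ : (r0 = 0 ∧ r1 = 1 ∧ r2 = 2 ∧ r3 = 3) ∨ (r0 = 3 ∧ r1 = 2 ∧ r2 = 1 ∧ r3 = 0))
    {K : SimpleGraph (Site 2)}
    (hK : ∀ u v, K.Adj u v ↔ (discreteDomainGraph (rectDomain (L + 1) 3) 1).Adj u v ∧
      (u ≠ st (L + 1 : ℕ) r0 ∧ u ≠ st (L + 1 : ℕ) r1 ∧ u ≠ st (L + 1 : ℕ) r2 ∧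
        u ≠ st (L + 1 : ℕ) r3) ∧
      (v ≠ st (L + 1 : ℕ) r0 ∧ v ≠ st (L + 1 : ℕ) r1 ∧ v ≠ st (L + 1 : ℕ) r2 ∧
        v ≠ st (L + 1 : ℕ) r3)) :
    K = discreteDomainGraph (rectDomain L 3) 1 := by
  -- adapted from `s4n_delete_lastColumn` (…BoundaryTP2Strip4RecNear)
  ext u v
  rw [hK, adj_rect_iff, adj_rect_iff]
  constructor
  · rintro ⟨⟨hzd, hu, hv⟩, ⟨hu0, hu1, hu2, hu3⟩, ⟨hv0, hv1, hv2, hv3⟩⟩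
    rw [mem_rectSites_iff] at hu hv
    rw [Ne, s4q_eq_st_iff] at hu0 hu1 hu2 hu3 hv0 hv1 hv2 hv3
    refine ⟨hzd, ?_, ?_⟩
    · clear hv0 hv1 hv2 hv3
      rw [mem_rectSites_iff]; omega
    · clear hu0 hu1 hu2 hu3
      rw [mem_rectSites_iff]; omega
  · rintro ⟨hzd, hu, hv⟩
    rw [mem_rectSites_iff] at hu hv
    refine ⟨⟨hzd, ?_, ?_⟩, ⟨?_, ?_, ?_, ?_⟩, ⟨?_, ?_, ?_, ?_⟩⟩
    · rw [mem_rectSites_iff]; omega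
    · rw [mem_rectSites_iff]; omega
    all_goals rw [Ne, s4q_eq_st_iff]; omega

/-! ## The recursion -/

open Classical in
/-- STUB W4-C5 (`stub_strip4_recPair302`). Width-4 last-column recursion for the disjoint-pair
kernel with main path into the corner `(L+1,ρ₃)` and loop `(L+1,ρ₀) → (L+1,ρ₂)`: the loop is
the column segment (`x³ Z`), dips `(L+1,ρ₁) → (L,ρ₁) ⋯ (L,ρ₂) → (L+1,ρ₂)`
(`x⁴ PP(ρ₃; ρ₁→ρ₂)`), or starts `(L+1,ρ₀) → (L,ρ₀)` and re-enters the column at `(L+1,ρ₂)`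
(`x³ PP(ρ₃; ρ₀→ρ₂)`) or at `(L+1,ρ₁)` (`x⁴ PP(ρ₃; ρ₀→ρ₁)`); the main path enters the corner
from `(L,ρ₃)`. Obtained by peeling the new column vertex by vertex with the generic first-step /
pendant-vertex identities of the pair kernel (`…Strip4RecPair302Aux`, `…Strip4RecCornerAux`).
[folklore] -/
theorem stub_strip4_recPair302 (L : ℕ) {x : ℝ} (hx : 0 ≤ x) (r : ℤ) (hr : 0 ≤ r ∧ r ≤ 3) (r0 r1 r2 r3 : ℤ)
    (hρ : (r0 = 0 ∧ r1 = 1 ∧ r2 = 2 ∧ r3 = 3) ∨ (r0 = 3 ∧ r1 = 2 ∧ r2 = 1 ∧ r3 = 0)) :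
    (∑' (γ : (discreteDomainGraph (rectDomain (L + 1) 3) 1).Path (st 0 r) (st (L + 1 : ℕ) r3))
        (γ' : (discreteDomainGraph (rectDomain (L + 1) 3) 1).Path (st (L + 1 : ℕ) r0) (st (L + 1 : ℕ) r2)),
      (if List.Disjoint γ.1.support γ'.1.support then
        ENNReal.ofReal (x ^ γ.1.length) * ENNReal.ofReal (x ^ γ'.1.length) else 0)) =
      ENNReal.ofReal (x ^ 3) * pathKernel (discreteDomainGraph (rectDomain L 3) 1) x (st 0 r) (st L r3) +
        ENNReal.ofReal (x ^ 4) *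
          (∑' (γ : (discreteDomainGraph (rectDomain L 3) 1).Path (st 0 r) (st L r3))
              (γ' : (discreteDomainGraph (rectDomain L 3) 1).Path (st L r0) (st L r1)),
            (if List.Disjoint γ.1.support γ'.1.support then
              ENNReal.ofReal (x ^ γ.1.length) * ENNReal.ofReal (x ^ γ'.1.length) else 0)) +
        ENNReal.ofReal (x ^ 3) *
          (∑' (γ : (discreteDomainGraph (rectDomain L 3) 1).Path (st 0 r) (st L r3))
              (γ' : (discreteDomainGraph (rectDomain L 3) 1).Path (st L r0) (st L r2)),
            (if List.Disjoint γ.1.support γ'.1.support then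
              ENNReal.ofReal (x ^ γ.1.length) * ENNReal.ofReal (x ^ γ'.1.length) else 0)) +
        ENNReal.ofReal (x ^ 4) *
          (∑' (γ : (discreteDomainGraph (rectDomain L 3) 1).Path (st 0 r) (st L r3))
              (γ' : (discreteDomainGraph (rectDomain L 3) 1).Path (st L r1) (st L r2)),
            (if List.Disjoint γ.1.support γ'.1.support then
              ENNReal.ofReal (x ^ γ.1.length) * ENNReal.ofReal (x ^ γ'.1.length) else 0)) := by
  obtain ⟨-, -⟩ := hr -- the row constraint on the start is not needed
  -- distinctness of the sites involved (columns `0`, `L` versus `L + 1`; distinct rows)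
  have hm0a : st (L + 1 : ℕ) r0 ≠ st 0 r := s4q_ne (by omega)
  have hm1a : st (L + 1 : ℕ) r1 ≠ st 0 r := s4q_ne (by omega)
  have hm2a : st (L + 1 : ℕ) r2 ≠ st 0 r := s4q_ne (by omega)
  have hta : st (L + 1 : ℕ) r3 ≠ st 0 r := s4q_ne (by omega)
  have hm0m2 : st (L + 1 : ℕ) r0 ≠ st (L + 1 : ℕ) r2 := s4q_ne (by omega)
  have hm1m2 : st (L + 1 : ℕ) r1 ≠ st (L + 1 : ℕ) r2 := s4q_ne (by omega)
  have hm1t : st (L + 1 : ℕ) r1 ≠ st (L + 1 : ℕ) r3 := s4q_ne (by omega)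
  have htm2 : st (L + 1 : ℕ) r3 ≠ st (L + 1 : ℕ) r2 := s4q_ne (by omega)
  have hp0m1 : st (L : ℤ) r0 ≠ st (L + 1 : ℕ) r1 := s4q_ne (by omega)
  have hp1m2 : st (L : ℤ) r1 ≠ st (L + 1 : ℕ) r2 := s4q_ne (by omega)
  have hp2m1 : st (L : ℤ) r2 ≠ st (L + 1 : ℕ) r1 := s4q_ne (by omega)
  have hp2t : st (L : ℤ) r2 ≠ st (L + 1 : ℕ) r3 := s4q_ne (by omega)
  have hp0t : st (L : ℤ) r0 ≠ st (L + 1 : ℕ) r3 := s4q_ne (by omega)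
  have hm2p0 : st (L + 1 : ℕ) r2 ≠ st L r0 := s4q_ne (by omega)
  have hm2p1 : st (L + 1 : ℕ) r2 ≠ st L r1 := s4q_ne (by omega)
  have htp1 : st (L + 1 : ℕ) r3 ≠ st L r1 := s4q_ne (by omega)
  set S' := discreteDomainGraph (rectDomain (L + 1) 3) 1 with hS'
  set S := discreteDomainGraph (rectDomain L 3) 1 with hS
  -- the intermediate graphs: the new column peeled vertex by vertex
  set A := S'.deleteEdges (S'.incidenceSet (st (L + 1 : ℕ) r0)) with hA
  set B := A.deleteEdges (A.incidenceSet (st (L + 1 : ℕ) r1)) with hB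
  set C := B.deleteEdges (B.incidenceSet (st (L + 1 : ℕ) r2)) with hC
  set D := A.deleteEdges (A.incidenceSet (st (L + 1 : ℕ) r2)) with hD
  set D₁ := D.deleteEdges (D.incidenceSet (st (L + 1 : ℕ) r1)) with hD₁
  -- neighbourhoods of the column sites in the intermediate graphs
  have hNm0 : ∀ w, S'.Adj (st (L + 1 : ℕ) r0) w ↔ w = st L r0 ∨ w = st (L + 1 : ℕ) r1 :=
    fun w => by rw [hS', s4q_adj_iff]; simp only [s4q_eq_st_iff, st_zero, st_one]; omega
  have hNAm1 : ∀ w, A.Adj (st (L + 1 : ℕ) r1) w ↔ w = st L r1 ∨ w = st (L + 1 : ℕ) r2 :=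
    fun w => by
      simp only [hA, hS', deleteEdges_incidenceSet_adj, s4q_adj_iff, Ne, s4q_eq_st_iff, st_zero,
        st_one]; omega
  have hNAm2 : ∀ w, A.Adj (st (L + 1 : ℕ) r2) w ↔
      w = st L r2 ∨ w = st (L + 1 : ℕ) r1 ∨ w = st (L + 1 : ℕ) r3 := fun w => by
    simp only [hA, hS', deleteEdges_incidenceSet_adj, s4q_adj_iff, Ne, s4q_eq_st_iff, st_zero,
      st_one]; omega
  have hNBm2 : ∀ w, B.Adj (st (L + 1 : ℕ) r2) w ↔ w = st L r2 ∨ w = st (L + 1 : ℕ) r3 :=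
    fun w => by
      simp only [hB, hA, hS', deleteEdges_incidenceSet_adj, s4q_adj_iff, Ne, s4q_eq_st_iff,
        st_zero, st_one]; omega
  have hNCt : ∀ w, C.Adj (st (L + 1 : ℕ) r3) w ↔ w = st L r3 := fun w => by
    simp only [hC, hB, hA, hS', deleteEdges_incidenceSet_adj, s4q_adj_iff, Ne, s4q_eq_st_iff,
      st_zero, st_one]; omega
  have hNDm1 : ∀ w, D.Adj (st (L + 1 : ℕ) r1) w ↔ w = st L r1 := fun w => by
    simp only [hD, hA, hS', deleteEdges_incidenceSet_adj, s4q_adj_iff, Ne, s4q_eq_st_iff, st_zero,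
      st_one]; omega
  have hND₁t : ∀ w, D₁.Adj (st (L + 1 : ℕ) r3) w ↔ w = st L r3 := fun w => by
    simp only [hD₁, hD, hA, hS', deleteEdges_incidenceSet_adj, s4q_adj_iff, Ne, s4q_eq_st_iff,
      st_zero, st_one]; omega
  -- the old graph is what is left after the whole column is deleted
  have hE₁ : C.deleteEdges (C.incidenceSet (st (L + 1 : ℕ) r3)) = S :=
    s4q_delete_column L r0 r1 r2 r3 hρ fun u v => by
      rw [deleteEdges_incidenceSet_adj, hC, deleteEdges_incidenceSet_adj, hB,
        deleteEdges_incidenceSet_adj, hA, deleteEdges_incidenceSet_adj]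
      tauto
  have hE₂ : D₁.deleteEdges (D₁.incidenceSet (st (L + 1 : ℕ) r3)) = S :=
    s4q_delete_column L r0 r1 r2 r3 hρ fun u v => by
      rw [deleteEdges_incidenceSet_adj, hD₁, deleteEdges_incidenceSet_adj, hD,
        deleteEdges_incidenceSet_adj, hA, deleteEdges_incidenceSet_adj]
      tauto
  -- the pendant vertices met on the way: `t` hanging on `p₃`, the stranded `m₁` on `p₁`
  have hCt : ∀ z, C.Adj (st (L + 1 : ℕ) r3) z → z = st L r3 := fun z hz => (hNCt z).1 hz
  have hCt' : C.Adj (st L r3) (st (L + 1 : ℕ) r3) := ((hNCt _).2 rfl).symm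
  have hD₁t : ∀ z, D₁.Adj (st (L + 1 : ℕ) r3) z → z = st L r3 := fun z hz => (hND₁t z).1 hz
  have hD₁t' : D₁.Adj (st L r3) (st (L + 1 : ℕ) r3) := ((hND₁t _).2 rfl).symm
  have hDm1 : ∀ z, D.Adj (st (L + 1 : ℕ) r1) z → z = st L r1 := fun z hz => (hNDm1 z).1 hz
  have hDm1' : D.Adj (st (L + 1 : ℕ) r1) (st L r1) := (hNDm1 _).2 rfl
  -- first step of the loop at the corner `m₀ = (L+1, ρ₀)`: towards `p₀ = (L, ρ₀)` or to `m₁`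
  rw [pairSum_firstStep_pair S' x hx hm0a hm0m2 hNm0 hp0m1, ← hA]
  -- (b) towards `p₀`: the loop re-enters the column at `m₂`, from `p₂` (b1: `m₁` is stranded)
  -- or from `m₁` after `p₁` (b2); either way the main path enters `t` from `p₃`
  rw [s4c_pair_reverse_right A x _ _ (st L r0) (st (L + 1 : ℕ) r2),
    pairSum_firstStep_triple A x hx hm2a hm2p0 hNAm2 hp2m1 hp2t hm1t, ← hD, s4c_pair_diag D x,
    add_zero, s4c_pair_leaf_irrel D D₁ x hD₁ hDm1 hm1a.symm hm1t.symm hp2m1 hp0m1,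
    s4c_pair_leaf_end D₁ S x hx hE₂.symm hD₁t hD₁t' hta.symm hp2t hp0t,
    s4c_pair_reverse_right S x _ _ (st L r2) (st L r0),
    s4c_pair_leaf_start D D₁ x hx hD₁ hDm1 hDm1' hm1a.symm hm1t.symm hp0m1,
    s4c_pair_leaf_end D₁ S x hx hE₂.symm hD₁t hD₁t' hta.symm htp1.symm hp0t,
    s4c_pair_reverse_right S x _ _ (st L r1) (st L r0)]
  -- (a) to `m₁`: the loop is the column segment `m₀ m₁ m₂` (a1: the main path is any old path
  -- into `p₃`) or dips `m₁ p₁ ⋯ p₂ m₂` (a2)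
  rw [pairSum_firstStep_pair A x hx hm1a hm1m2 hNAm1 hp1m2, ← hB, pairSum_nil,
    stub_pathKernelOn_avoid B x _ _ _ hm2a.symm htm2, ← hC, pathKernel_comm C x,
    pathKernel_firstStep_single C x hx hta (Set.ext fun w => hNCt w), hE₁,
    pathKernel_comm S x (st L r3), s4c_pair_reverse_right B x _ _ (st L r1) (st (L + 1 : ℕ) r2),
    pairSum_firstStep_pair B x hx hm2a hm2p1 hNBm2 hp2t, ← hC, s4c_pair_diag C x, add_zero,
    s4c_pair_leaf_end C S x hx hE₁.symm hCt hCt' hta.symm hp2t htp1.symm,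
    s4c_pair_reverse_right S x _ _ (st L r2) (st L r1)]
  -- bookkeeping in `ℝ≥0∞`
  rw [ENNReal.ofReal_pow hx, ENNReal.ofReal_pow hx]
  ring

end Summit.CriticalPhenomena.SAWScalingLimit.Theorems.BoundaryTP2
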